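import Mathlib
import Summits.Ventures.HodgeRepro2.T5ProfiniteCharacterExtension

/-!
# A continuous additive character of a valued field is trivial on a ball

Tier-5 support for the (A6) step of §N5.12.6 / §N5.13.2 (route/T5-route-2.md): the hypothesis
«`ψ` is trivial on SOME ball» under which `T5AdditiveConductor.conductorExp` (p394996) is the
conductor exponent — left to prose there as «continuity of `ψ_F`» — is derived here from
continuity, for characters with values in the circle:

* `val_nsmul_le`: the balls `{x ∣ v x ≤ exp k}` are stable under `ℕ`-multiples (they are
  additive subgroups);
* `exists_forall_le_exp_eq_one_of_continuousAt`: if `ψ : AddChar K Circle` is continuous at `0`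
  and the balls form a neighbourhood basis of `0` (the valuation topology), then `ψ` is trivial
  on some ball — `{re > 0}` is a neighbourhood of `1` in the circle, its preimage contains a ball,
  every power `ψ x ^ n = ψ (n • x)` of a point of the image stays in `{re > 0}`, and the circle
  has NO SMALL SUBGROUPS (`T5ProfiniteCharacterExtension.eq_one_of_forall_pow_re_pos`, p391884);
* `continuous_of_forall_le_exp_eq_one`: conversely, a character trivial on a ball that is a
  neighbourhood of `0` is locally constant, hence continuous.

Nothing here mentions a local field beyond «a field with a `ℤᵐ⁰`-valued valuation and a topology
in which the balls are neighbourhoods of `0`».  Uses an L-value-free non-vanishing device: NO.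
-/

namespace Summit.Ventures.HodgeRepro2.T5ContinuousCharacterBall

open WithZero Filter Topology

variable {K : Type*} [Field K] (v : Valuation K (WithZero (Multiplicative ℤ)))

/-- The balls `{x ∣ v x ≤ exp k}` are stable under `ℕ`-multiples. -/
theorem val_nsmul_le {k : ℤ} {x : K} (hx : v x ≤ exp k) (n : ℕ) : v (n • x) ≤ exp k := by
  induction n with
  | zero => rw [zero_smul, Valuation.map_zero]; exact zero_le
  | succ n ih => rw [succ_nsmul]; exact (v.map_add _ _).trans (max_le ih hx)

/-- `{z ∣ re z > 0}` is a neighbourhood of `1` in the circle. -/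
theorem rePos_mem_nhds_one : {z : Circle | 0 < (z : ℂ).re} ∈ 𝓝 (1 : Circle) := by
  have hcont : Continuous fun z : Circle => (z : ℂ).re :=
    Complex.continuous_re.comp continuous_subtype_val
  exact (isOpen_lt continuous_const hcont).mem_nhds (by simp)

/-- A character of `K` with values in the circle, continuous at `0`, is trivial on some ball,
provided the balls form a neighbourhood basis of `0`. -/
theorem exists_forall_le_exp_eq_one_of_continuousAt [TopologicalSpace K]
    (ψ : AddChar K Circle) (hψ : ContinuousAt ψ 0)
    (hnhds : ∀ s ∈ 𝓝 (0 : K), ∃ k : ℤ, ∀ x : K, v x ≤ exp k → x ∈ s) :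
    ∃ k : ℤ, ∀ x : K, v x ≤ exp k → ψ x = 1 := by
  have h1 : ψ ⁻¹' {z : Circle | 0 < (z : ℂ).re} ∈ 𝓝 (0 : K) :=
    hψ.preimage_mem_nhds (by rw [AddChar.map_zero_eq_one]; exact rePos_mem_nhds_one)
  obtain ⟨k, hk⟩ := hnhds _ h1
  refine ⟨k, fun x hx => ?_⟩
  apply T5ProfiniteCharacterExtension.eq_one_of_forall_pow_re_pos
  intro n
  rw [← AddChar.map_nsmul_eq_pow]
  exact hk _ (val_nsmul_le v hx n)

/-- The same for a continuous character. -/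
theorem exists_forall_le_exp_eq_one_of_continuous [TopologicalSpace K]
    (ψ : AddChar K Circle) (hψ : Continuous ψ)
    (hnhds : ∀ s ∈ 𝓝 (0 : K), ∃ k : ℤ, ∀ x : K, v x ≤ exp k → x ∈ s) :
    ∃ k : ℤ, ∀ x : K, v x ≤ exp k → ψ x = 1 :=
  exists_forall_le_exp_eq_one_of_continuousAt v ψ hψ.continuousAt hnhds

/-- Conversely, a character trivial on a ball that is a neighbourhood of `0` is locally constant,
hence continuous (`K` a topological additive group; any target monoid with a topology). -/
theorem continuous_of_forall_le_exp_eq_one [TopologicalSpace K] [IsTopologicalAddGroup K]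
    {M : Type*} [Monoid M] [TopologicalSpace M] (ψ : AddChar K M) (k : ℤ)
    (hk : ∀ x : K, v x ≤ exp k → ψ x = 1) (hball : {x : K | v x ≤ exp k} ∈ 𝓝 (0 : K)) :
    Continuous ψ := by
  rw [continuous_iff_continuousAt]
  intro x
  have hev : ∀ᶠ y in 𝓝 x, ψ y = ψ x := by
    rw [← map_add_left_nhds_zero x, eventually_map]
    filter_upwards [hball] with y hy
    rw [AddChar.map_add_eq_mul, hk y hy, mul_one]
  exact tendsto_const_nhds.congr' (hev.mono fun y hy => hy.symm)

end Summit.Ventures.HodgeRepro2.T5ContinuousCharacterBall
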